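import Summits.Ventures.HSemireg.WedgeHankelRecurrenceHankelDeterminantStep
import Summits.Ventures.HSemireg.WedgeHankelRecurrenceGundelfinger

/-!
# Venture HSemireg — SCHUR COMPLEMENTS AND HANKEL FORMS WHOSE RANK IS CARRIED BY A LEADING MINOR: over any field **`rank [A B; C D] = rank A + rank (D − C A⁻¹ B)`** (`det A` a unit); for a
# symmetric `[A B; Bᵀ D]` of rank `rank A` with `A` invertible, **inertia = inertia of `A`**; for Hankel forms: leading blocks have smaller rank, the leading minors of order `> rank` vanish, and
# if `det H_{r'}(q) ≠ 0`, `rank H_t(q) = r' + 1`, `r' ≤ t` then **`sigPos ∕ sigNeg H_t(q) = sigPos ∕ sigNeg H_{r'}(q)`** — the reduction behind Frobenius' rule for SINGULAR Hankel forms and behind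
# BPR Prop. 9.25 a) (`p ≤ n`: the signature of `Han(s̄_n)` is that of its invertible `p × p` head)

HONEST FRAMING. Part of the Lean index of the computation cell `pub-hsemireg` (seat p10 gen 37, Sunday typer «UNIFORM-IN-n»).
LINEAR ALGEBRA OF SYMMETRIC ∕ HANKEL MATRICES OVER A (LINEARLY ORDERED) FIELD ONLY (Mathlib's `sigPos` ∕ `sigNeg`, `Matrix.rank`, block LDU `fromBlocks_eq_of_invertible₁₁`; PROVED Literature
`ABVersusBAJordanStructure.rank_fromBlocks_zero₁₂_zero₂₁`): no variety, no cohomology theory, no sheaf, no Ext group and no semiregularity map is constructed here; nothing here says that HC /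
HC_CM / HC_AV holds; no Literature fact (unproved `Prop`) is declared or used.  Custodian versions as in `WedgeHankelSiegelIdeal` (1/3).
SOURCE OF THE ARGUMENT (cited; held text read, `book:basu2006-algorithms-real-algebraic-geometry` pp. 339–340): S. Basu, R. Pollack, M.-F. Roy, *Algorithms in Real Algebraic Geometry* (2006)
§9.2.2 Prop. 9.25 a) («Suppose `p ≤ n`. Then `Sign(Han(s̄_n)) = PmV(han(s̄_{[0..n]})) = … = Ind(Q/P)`»: the rank `p` of `Han(s̄_n)` is carried by the invertible head `Han(s̄_p)`) and Remark 9.27 c);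
the Schur-complement step is textbook (R. A. Horn, C. R. Johnson, *Matrix Analysis* (2013) 0.8.5; Mathlib `Matrix.fromBlocks_eq_of_invertible₁₁`).  The `PmV` reading (Frobenius' rule with
gaps) is the CHAINED successor pair `…HankelPmV` (definition lane) ∕ `…HankelPmVRank`.
DEDUP DISCLOSURE (`rg` of the whole tree + Mathlib, 2026-09-01): N138 (`…Jacobi`) has the inertia ADDITIVITY `sigPos [A B; Bᵀ D] = sigPos A + sigPos (D − BᵀA⁻¹B)`; Literature `rank_fromBlocks_zero₁₂_zero₂₁`
(block-diagonal rank) and Mathlib `det_fromBlocks₁₁` exist but no rank additivity over a Schur complement (`rg "A⁻¹ \* B).rank"`: 0 hits); N142 compares `rank H_t(b/m)` across sizes `t ≥ e`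
only; N169 has `det_eq_zero_of_rank_lt`; nothing in the tree transfers inertia from a leading Hankel block carrying the rank — that is this file (v1 bounced `dedup.landed` on a restated Schur-symmetry lemma, now cited from N143).  6 names: 0 hits tree-wide.

WHAT IS IN THE TREE.  N169 `det_eq_zero_of_rank_lt`; N143 (`…Gundelfinger`) `isSymm_sub_transpose_mul_inv_mul`; N138 **`sigPos_toQuadraticForm'_fromBlocks`** ∕ `sigNeg_…`, `sigPos_sigNeg_toQuadraticForm'_submatrix_equiv`; N132 `rank_eq_sigPos_add_sigNeg`, `hankelSq_isSymm`;
Literature `rank_fromBlocks_zero₁₂_zero₂₁`.  Mathlib: `Matrix.fromBlocks_eq_of_invertible₁₁`, `invertibleOfIsUnitDet`, `invOf_eq_nonsing_inv`, `det_fromBlocks_zero₁₂ ∕ zero₂₁`,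
`rank_mul_eq_left ∕ right_of_isUnit_det`, `rank_mul_le_left ∕ right`, `transpose_nonsing_inv`, `rank_reindex`, `rank_of_isUnit`, `Matrix.one_apply_ne ∕ _ne'`.
THIS FILE (namespace `Summit.Ventures.HSemireg.Wedge.HankelOuter` continued; PLAIN over N169 + N143 (tree); 0 definitions):
* §814 SCHUR: **`rank_fromBlocks_eq_add_rank_schur`** (any field), **`sigPos_sigNeg_fromBlocks_of_rank_eq`** (with N143's `isSymm_sub_transpose_mul_inv_mul` for the symmetry of the Schur complement) (symmetric `[A B; Bᵀ D]` of rank `rank A`, `A` invertible ⇒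
  inertia of `A`).
* §815 HANKEL: `rank_hankelSq_le_of_le` (leading blocks have smaller rank), **`det_hankelSq_eq_zero_of_rank_le`** (minors beyond the rank vanish), `hankelSq_submatrix_eq_fromBlocks` (`H_t` as
  `[H_{r'} B; Bᵀ D]`), **`sigPos_sigNeg_hankelSq_eq_of_rank_eq`** (inertia of `H_t(q)` = inertia of `H_{r'}(q)` when `det H_{r'}(q) ≠ 0`, `rank H_t(q) = r' + 1`).
CAVEATS.  The rank must be CARRIED by the leading block (`D_{rank} ≠ 0`); Hankel forms with `D_{rank} = 0` (e.g. `s = (0, …, 0, 1)`) are outside this reduction (BPR's Prop. 9.25 b) through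
subresultants is NOT typed).  Nothing Ext-side.  New names only.
-/

open Module Polynomial
open scoped Matrix Polynomial

namespace Summit.Ventures.HSemireg.Wedge.HankelOuter

open Summit.Ventures.HSemireg.Wedge Summit.Ventures.HSemireg.Wedge.Hankel

/-! ## §814. Schur complements: rank is additive over an invertible leading block; a symmetric matrix whose rank is carried by an invertible leading block has the inertia of that block -/

section Schur

variable {K : Type*} [Field K] {m n : Type*} [Fintype m] [Fintype n] [DecidableEq m] [DecidableEq n]

/-- **`rank [A B; C D] = rank A + rank (D − C A⁻¹ B)`** for `A` with unit determinant (block LDU, Mathlib `fromBlocks_eq_of_invertible₁₁`; any field). [this file, §814] -/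
theorem rank_fromBlocks_eq_add_rank_schur {A : Matrix m m K} (hAu : IsUnit A.det) (B : Matrix m n K) (C : Matrix n m K) (D : Matrix n n K) :
    (Matrix.fromBlocks A B C D).rank = A.rank + (D - C * A⁻¹ * B).rank := by
  have _i : Invertible A := Matrix.invertibleOfIsUnitDet A hAu
  rw [Matrix.fromBlocks_eq_of_invertible₁₁ A B C D, Matrix.invOf_eq_nonsing_inv]
  have h1 : IsUnit (Matrix.fromBlocks (1 : Matrix m m K) 0 (C * A⁻¹) (1 : Matrix n n K)).det := by
    rw [Matrix.det_fromBlocks_zero₁₂, Matrix.det_one, Matrix.det_one, one_mul]; exact isUnit_one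
  have h2 : IsUnit (Matrix.fromBlocks (1 : Matrix m m K) (A⁻¹ * B) 0 (1 : Matrix n n K)).det := by
    rw [Matrix.det_fromBlocks_zero₂₁, Matrix.det_one, Matrix.det_one, one_mul]; exact isUnit_one
  rw [Matrix.rank_mul_eq_left_of_isUnit_det _ _ h2, Matrix.rank_mul_eq_right_of_isUnit_det _ _ h1, Literature.LinearAlgebra.Matrix.rank_fromBlocks_zero₁₂_zero₂₁]

variable [LinearOrder K] [IsStrictOrderedRing K]

/-- **If `M = [A B; Bᵀ D]` is symmetric, `A` is invertible and `rank M = rank A`, then `sigPos M = sigPos A` and `sigNeg M = sigNeg A`** (the Schur complement is symmetric of rank `0`,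
hence of zero inertia; N138 `sigPos ∕ sigNeg_toQuadraticForm'_fromBlocks`, N132 `rank_eq_sigPos_add_sigNeg`). [this file, §814] -/
theorem sigPos_sigNeg_fromBlocks_of_rank_eq {A : Matrix m m K} (hA : A.IsSymm) (hAu : IsUnit A.det) (B : Matrix m n K) {D : Matrix n n K} (hD : D.IsSymm)
    (hrank : (Matrix.fromBlocks A B Bᵀ D).rank = A.rank) :
    sigPos (Matrix.fromBlocks A B Bᵀ D).toQuadraticForm' = sigPos A.toQuadraticForm' ∧ sigNeg (Matrix.fromBlocks A B Bᵀ D).toQuadraticForm' = sigNeg A.toQuadraticForm' := by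
  have hS := rank_eq_sigPos_add_sigNeg (isSymm_sub_transpose_mul_inv_mul hA B hD)
  rw [rank_fromBlocks_eq_add_rank_schur hAu B Bᵀ D] at hrank
  have hS0 : (D - Bᵀ * A⁻¹ * B).rank = 0 := by omega
  rw [sigPos_toQuadraticForm'_fromBlocks hA hAu B D, sigNeg_toQuadraticForm'_fromBlocks hA hAu B D]
  constructor <;> omega

end Schur

/-! ## §815. Hankel forms whose rank is carried by a non-vanishing leading minor: `sigPos ∕ sigNeg H_t(s) = sigPos ∕ sigNeg H_{r−1}(s)` (Frobenius' reduction for SINGULAR forms with `D_r ≠ 0`) -/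

section HankelRank

variable {K : Type*} [Field K]

/-- A leading principal submatrix has smaller rank: `rank H_k(q) ≤ rank H_t(q)` for `k ≤ t`. [this file, §815] -/
theorem rank_hankelSq_le_of_le {k t : ℕ} (hkt : k ≤ t) (q : ℕ → K) : (hankelSq K k q).rank ≤ (hankelSq K t q).rank := by
  have hk : k + 1 ≤ t + 1 := by omega
  have h : hankelSq K k q = ((1 : Matrix (Fin (t + 1)) (Fin (t + 1)) K).submatrix (Fin.castLE hk) id) * hankelSq K t q * ((1 : Matrix (Fin (t + 1)) (Fin (t + 1)) K).submatrix id (Fin.castLE hk)) := by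
    ext i j
    rw [Matrix.mul_apply, Finset.sum_eq_single (Fin.castLE hk j) (fun b _ hb => by rw [Matrix.submatrix_apply, id, Matrix.one_apply_ne hb, mul_zero]) (fun h => absurd (Finset.mem_univ _) h),
      Matrix.submatrix_apply, id, Matrix.one_apply_eq, mul_one, Matrix.mul_apply,
      Finset.sum_eq_single (Fin.castLE hk i) (fun b _ hb => by rw [Matrix.submatrix_apply, id, Matrix.one_apply_ne' hb, zero_mul]) (fun h => absurd (Finset.mem_univ _) h),
      Matrix.submatrix_apply, id, Matrix.one_apply_eq, one_mul]
    simp only [hankelSq, Matrix.of_apply, Fin.val_castLE]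
  rw [h]
  exact (Matrix.rank_mul_le_left _ _).trans (Matrix.rank_mul_le_right _ _)

/-- **The leading minors beyond the rank vanish: `det H_k(q) = 0` for `rank H_t(q) ≤ k ≤ t`.** [this file, §815] -/
theorem det_hankelSq_eq_zero_of_rank_le {k t : ℕ} (hkt : k ≤ t) (q : ℕ → K) (hr : (hankelSq K t q).rank ≤ k) : (hankelSq K k q).det = 0 :=
  det_eq_zero_of_rank_lt (by rw [Fintype.card_fin]; exact lt_of_le_of_lt ((rank_hankelSq_le_of_le hkt q).trans hr) (Nat.lt_succ_self k))

omit [Field K] in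
/-- `H_t(q)` re-indexed along `Fin (r'+1) ⊕ Fin (u+1) ≃ Fin (t+1)` (`t + 1 = (r'+1) + (u+1)`) is the symmetric block matrix `[H_{r'}(q) B; Bᵀ D]` with `B = (q_{i + r' + 1 + j})`,
`D = (q_{2r' + 2 + i + j})`. [this file, §815] -/
theorem hankelSq_submatrix_eq_fromBlocks {t r' u : ℕ} (q : ℕ → K) (E : Fin (r' + 1) ⊕ Fin (u + 1) ≃ Fin (t + 1)) (hE1 : ∀ k, ((E (Sum.inl k) : Fin (t + 1)) : ℕ) = k)
    (hE2 : ∀ k, ((E (Sum.inr k) : Fin (t + 1)) : ℕ) = r' + 1 + k) :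
    (hankelSq K t q).submatrix E E
      = Matrix.fromBlocks (hankelSq K r' q) (Matrix.of fun (i : Fin (r' + 1)) (j : Fin (u + 1)) => q ((i : ℕ) + (r' + 1 + j)))
          (Matrix.of fun (i : Fin (r' + 1)) (j : Fin (u + 1)) => q ((i : ℕ) + (r' + 1 + j)))ᵀ (hankelSq K u fun n => q (n + (2 * r' + 2))) := by
  ext (a | a) (b | b)
  · rw [Matrix.submatrix_apply, Matrix.fromBlocks_apply₁₁, hankelSq, hankelSq, Matrix.of_apply, Matrix.of_apply, hE1, hE1]
  · rw [Matrix.submatrix_apply, Matrix.fromBlocks_apply₁₂, hankelSq, Matrix.of_apply, Matrix.of_apply, hE1, hE2]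
  · rw [Matrix.submatrix_apply, Matrix.fromBlocks_apply₂₁, hankelSq, Matrix.of_apply, Matrix.transpose_apply, Matrix.of_apply, hE2, hE1]; congr 1; omega
  · rw [Matrix.submatrix_apply, Matrix.fromBlocks_apply₂₂, hankelSq, hankelSq, Matrix.of_apply, Matrix.of_apply, hE2, hE2]; congr 1; omega

variable [LinearOrder K] [IsStrictOrderedRing K]

/-- **FROBENIUS FOR SINGULAR HANKEL FORMS whose rank is carried by a leading minor: `det H_{r'}(q) ≠ 0`, `rank H_t(q) = r' + 1`, `r' ≤ t` ⇒ `sigPos H_t(q) = sigPos H_{r'}(q)` and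
`sigNeg H_t(q) = sigNeg H_{r'}(q)`** (linearly ordered field). [this file, §815] -/
theorem sigPos_sigNeg_hankelSq_eq_of_rank_eq {t r' : ℕ} (hr : r' ≤ t) (q : ℕ → K) (hdet : (hankelSq K r' q).det ≠ 0) (hrank : (hankelSq K t q).rank = r' + 1) :
    sigPos (hankelSq K t q).toQuadraticForm' = sigPos (hankelSq K r' q).toQuadraticForm' ∧ sigNeg (hankelSq K t q).toQuadraticForm' = sigNeg (hankelSq K r' q).toQuadraticForm' := by
  rcases Nat.eq_or_lt_of_le hr with rfl | hlt
  · exact ⟨rfl, rfl⟩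
  obtain ⟨u, ht⟩ : ∃ u, t = r' + u + 1 := ⟨t - r' - 1, by omega⟩
  obtain ⟨E, hE1, hE2⟩ : ∃ E : Fin (r' + 1) ⊕ Fin (u + 1) ≃ Fin (t + 1), (∀ k, ((E (Sum.inl k) : Fin (t + 1)) : ℕ) = k) ∧ ∀ k, ((E (Sum.inr k) : Fin (t + 1)) : ℕ) = r' + 1 + k :=
    ⟨finSumFinEquiv.trans (finCongr (by omega)), fun k => by simp, fun k => by simp⟩
  obtain ⟨hp, hn⟩ := sigPos_sigNeg_toQuadraticForm'_submatrix_equiv (hankelSq K t q) E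
  rw [← hp, ← hn, hankelSq_submatrix_eq_fromBlocks q E hE1 hE2]
  have hA := Matrix.rank_of_isUnit (hankelSq K r' q) ((Matrix.isUnit_iff_isUnit_det _).2 (isUnit_iff_ne_zero.2 hdet))
  refine sigPos_sigNeg_fromBlocks_of_rank_eq (hankelSq_isSymm K r' q) (isUnit_iff_ne_zero.2 hdet) _ (hankelSq_isSymm K u _) ?_
  rw [← hankelSq_submatrix_eq_fromBlocks q E hE1 hE2, show (hankelSq K t q).submatrix ⇑E ⇑E = Matrix.reindex E.symm E.symm (hankelSq K t q) by rw [Matrix.reindex_apply, Equiv.symm_symm],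
    Matrix.rank_reindex, hrank, hA, Fintype.card_fin]

end HankelRank

end Summit.Ventures.HSemireg.Wedge.HankelOuter
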